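import Summits.BirchSwinnertonDyer.BirchSwinnertonDyer.Theorems.ByReductionTypeAtTwoFineSelmerConjAAtTwoAdditivePotGoodInertDoor
import HarnessLib

/-!
# Route `ByReductionTypeAtTwo` (rung K4), crux C1″ `FineSelmerConjAAtTwoAdditivePotGood` (item stmt-BirchSwinnertonDyer-22615):
# THE EISENSTEIN DOOR — «`p, q, r` even and `4 ∤ r` ⟹ EXACTLY ONE prime of `ℚ(β)` above `2`» (KERNEL; `2` totally ramified),
# the second decidable splitting type of the unique-prime door
# (a `--supports 22615` file; seat `bsd-2adic-k4-w1` GEN 4; sequel of `…InertDoor`; pen RC-341 (b)/(c))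

HONEST FRAMING (cell `bsd-2adic`, D-0036/D-0054): types-the-object-of; closes nothing at the `∀`-level; nothing booked; BSD is
not proved by any of this. §1–§3 are UNCONDITIONAL kernel arithmetic; §4 is conditional on `hLim2` (Lim 2017 Thm. 3.5 at `2`)
BY NAME and on ONE displayed parity bit `2 ∤ #Cl(𝓞 ℚ(β))`.

THE ARGUMENT (elementary; no Kummer–Dedekind, no ramification theory). Let `K` be a CUBIC number field and `b ∈ 𝓞 K` a root of
`X³ + pX² + qX + r` with `p, q, r` even and `4 ∤ r` (Eisenstein at `2`; so the cubic is irreducible, `minpoly_ℚ(b)` is it, and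
`N_{K/ℚ}(b) = −r`, §1–§2). Every prime `v` above `2` contains `b` (`b³ = −(pb² + qb + r) ∈ 2𝓞 ⊆ v`), and has even norm
(`𝓞/v` is a finite field of characteristic `2`). Two distinct primes `v ≠ w` above `2` are comaximal and both contain `b`, so
`N(v)·N(w) ∣ N((b)) = |r|`, i.e. `4 ∣ r` — absurd. Hence EXACTLY ONE prime above `2`. In `…CurveFreeHeart`'s dictionary this is
the block `v₂ j = 9` (`2 = 𝔭³`), e.g. the pure cubic fields `ℚ(∛m)`, `m ≡ 2 mod 4`.

* §1 `irreducible_cubic_of_eisenstein` (Eisenstein at `2` + Gauss).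
* §2 number-field level: `norm_eq_neg_of_cubic_root` (`N(b) = −r` in a cubic field, via the power basis of `ℚ(b)`),
  `two_dvd_absNorm_of_two_mem`, `mem_asIdeal_of_two_mem_of_even`, **`existsUnique_two_mem_of_eisenstein_root`** (THE CRITERION).
* §3 cubic currency: **`existsUnique_two_mem_adjoin_of_eisenstein`**, **`classicalMuVanishes_two_adjoin_of_eisenstein`** (`p q r`
  even, `4 ∤ r`, `2 ∤ #Cl(𝓞 ℚ(β))` ⟹ `μ₂ = 0` (indeed `e_n = 0`) along EVERY `ℤ₂`-extension of `ℚ(β)` — UNCONDITIONAL).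
* §4 per curve (mod `hLim2` + the bit): `fineSelmerDual_moduleFinite_two_of_eisenstein_pointField`, cubic model
  `fineSelmerDual_moduleFinite_two_cubicModel_of_eisenstein`.
* §5 example: the pure cubic field `ℚ(∛2)` (`X³ − 2`; `h = 1` in print): `μ₂ = 0` along every `ℤ₂`-extension modulo `2 ∤ #Cl`.

With `…InertDoor` the unique-prime door is now KERNEL-DECIDABLE on both one-prime splitting types that a monogenic presentation
exhibits (`2` inert: no root mod `2`; `2 = 𝔭³`: Eisenstein); what stays displayed per class is the class-number parity.

References: [Greenberg2001IwasawaPastPresent] Prop. 2.1 p. 339; [Washington1997] Prop. 13.22; [Lim2017FineSelmer] Thm. 3.5, Lemma 3.2;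
[CoatesSujatha2005] (A); [Neukirch1999] I.(2.8), II.§6 (Eisenstein polynomials); [Cohen1993] App. B (h(ℚ(∛2)) = 1).
-/

set_option autoImplicit false
-- sibling precedent (`…InertDoor.lean`): the directory name repeats the summit name
set_option linter.dupNamespace false

noncomputable section

open scoped Classical IntermediateField NumberField

namespace Summit.BirchSwinnertonDyer.BirchSwinnertonDyer.Theorems.AddKatoTwo

open WeierstrassCurve Field Polynomial IsDedekindDomain Literature.NumberTheory.EllipticCurves
  Literature.NumberTheory.GaloisRepresentations
  Literature.NumberTheory.IwasawaTheory
  Summit.BirchSwinnertonDyer.BirchSwinnertonDyer.Theorems.AlignedTransportAtTwoTorsionPointField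
  Summit.BirchSwinnertonDyer.BirchSwinnertonDyer.Theses.ByReductionTypeAtTwo

/-! ## §1 Eisenstein at `2` -/

section Eisenstein

/-- **`p, q, r` even and `4 ∤ r` ⟹ `X³ + pX² + qX + r` is irreducible over `ℚ`** (Eisenstein's criterion at `2` over `ℤ`, then
Gauss). [folklore] -/
theorem irreducible_cubic_of_eisenstein {p q r : ℤ} (hp : Even p) (hq : Even q) (hr : Even r) (hr4 : ¬ (4 : ℤ) ∣ r) :
    Irreducible (Cubic.toPoly ⟨1, (p : ℚ), q, r⟩) := by
  have hnd : (Cubic.toPoly ⟨(1 : ℤ), p, q, r⟩).natDegree = 3 := Cubic.natDegree_of_a_ne_zero' one_ne_zero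
  have hprime : (Ideal.span {(2 : ℤ)}).IsPrime := by
    rw [Ideal.span_singleton_prime (by norm_num)]; exact Int.prime_two
  have hE : (Cubic.toPoly ⟨(1 : ℤ), p, q, r⟩).IsEisensteinAt (Ideal.span {(2 : ℤ)}) := by
    refine ⟨?_, ?_, ?_⟩
    · rw [Cubic.leadingCoeff_of_a_ne_zero' one_ne_zero, Ideal.mem_span_singleton]; norm_num
    · intro n hn
      rw [hnd] at hn
      rw [Ideal.mem_span_singleton]
      interval_cases n
      · rw [Cubic.coeff_eq_d]; exact even_iff_two_dvd.mp hr
      · rw [Cubic.coeff_eq_c]; exact even_iff_two_dvd.mp hq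
      · rw [Cubic.coeff_eq_b]; exact even_iff_two_dvd.mp hp
    · rw [Cubic.coeff_eq_d, Ideal.span_singleton_pow, Ideal.mem_span_singleton]; norm_num; exact hr4
  have hZ : Irreducible (Cubic.toPoly ⟨(1 : ℤ), p, q, r⟩) :=
    hE.irreducible hprime (Cubic.monic_of_a_eq_one').isPrimitive (by rw [hnd]; norm_num)
  have hQ := ((Cubic.monic_of_a_eq_one' (b := p) (c := q) (d := r)).irreducible_iff_irreducible_map_fraction_map
    (K := ℚ)).mp hZ
  rw [← Cubic.map_toPoly] at hQ
  simpa [Cubic.map] using hQ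

end Eisenstein

/-! ## §2 THE EISENSTEIN CRITERION for a cubic number field -/

section EisensteinCriterion

variable (K : Type) [Field K] [NumberField K]

/-- **`N_{K/ℚ}(b) = −r`** for a root `b ∈ 𝓞 K` of an IRREDUCIBLE monic integer cubic `X³ + pX² + qX + r` in a CUBIC number field
`K` (then `K = ℚ(b)` and the norm of the power-basis generator is `(−1)³ ×` the constant coefficient of its minimal polynomial).
[folklore] -/
theorem norm_eq_neg_of_cubic_root (h3 : Module.finrank ℚ K = 3) (b : 𝓞 K) {p q r : ℤ}
    (hirr : Irreducible (Cubic.toPoly ⟨1, (p : ℚ), q, r⟩))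
    (hb : b ^ 3 + p * b ^ 2 + q * b + r = 0) : Algebra.norm ℤ b = -r := by
  set x : K := (b : K) with hxdef
  have hfm : (Cubic.toPoly ⟨1, (p : ℚ), q, r⟩).Monic := Cubic.monic_of_a_eq_one'
  have hxK : x ^ 3 + (p : K) * x ^ 2 + (q : K) * x + (r : K) = 0 := by
    have := congrArg (algebraMap (𝓞 K) K) hb
    simpa [hxdef] using this
  have hxroot : aeval x (Cubic.toPoly ⟨1, (p : ℚ), q, r⟩) = 0 := by
    simp only [Cubic.toPoly, map_one, one_mul, aeval_add, aeval_mul, aeval_C, aeval_X_pow, aeval_X,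
      eq_ratCast, Rat.cast_intCast]
    exact hxK
  have hint : IsIntegral ℚ x := ⟨_, hfm, by rwa [← aeval_def]⟩
  have hmin : minpoly ℚ x = Cubic.toPoly ⟨1, (p : ℚ), q, r⟩ := (minpoly.eq_of_irreducible_of_monic hirr hxroot hfm).symm
  have hnd : (Cubic.toPoly ⟨1, (p : ℚ), q, r⟩).natDegree = 3 := Cubic.natDegree_of_a_ne_zero' one_ne_zero
  have hpb := Algebra.PowerBasis.norm_gen_eq_coeff_zero_minpoly (IntermediateField.adjoin.powerBasis hint)
  rw [IntermediateField.adjoin.powerBasis_gen, IntermediateField.adjoin.powerBasis_dim,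
    IntermediateField.minpoly_gen, hmin, hnd, Cubic.coeff_eq_d] at hpb
  have hdeg : Module.finrank ℚ ℚ⟮x⟯ = 3 := by rw [IntermediateField.adjoin.finrank hint, hmin, hnd]
  have h1 : Module.finrank ℚ⟮x⟯ K = 1 := by
    have := Module.finrank_mul_finrank ℚ ℚ⟮x⟯ K
    rw [hdeg, h3] at this
    omega
  have hnx : Algebra.norm ℚ x = -r := by
    rw [Algebra.norm_eq_norm_adjoin ℚ x, h1, pow_one]
    refine hpb.trans ?_
    show (-1 : ℚ) ^ 3 * (r : ℚ) = -(r : ℚ)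
    ring
  have := Algebra.coe_norm_int b
  rw [← hxdef, hnx] at this
  exact_mod_cast this

/-- Every prime above `2` has EVEN norm (its residue field has characteristic `2`). [folklore] -/
theorem two_dvd_absNorm_of_two_mem (v : HeightOneSpectrum (𝓞 K)) (h2 : ((2 : ℕ) : 𝓞 K) ∈ v.asIdeal) :
    2 ∣ Ideal.absNorm v.asIdeal := by
  haveI := v.isMaximal
  letI := Ideal.Quotient.field v.asIdeal
  haveI : Finite (𝓞 K ⧸ v.asIdeal) := Ideal.finiteQuotientOfFreeOfNeBot v.asIdeal v.ne_bot
  haveI := Fintype.ofFinite (𝓞 K ⧸ v.asIdeal)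
  rw [Ideal.absNorm_apply, Submodule.cardQuot_apply, Nat.card_eq_fintype_card]
  have h2k : (2 : 𝓞 K ⧸ v.asIdeal) = 0 := by
    have := Ideal.Quotient.eq_zero_iff_mem.mpr h2
    rwa [Nat.cast_ofNat, map_ofNat] at this
  haveI : CharP (𝓞 K ⧸ v.asIdeal) 2 := (CharP.charP_iff_prime_eq_zero Nat.prime_two).mpr (by exact_mod_cast h2k)
  obtain ⟨n, -, hcard⟩ := FiniteField.card (𝓞 K ⧸ v.asIdeal) 2
  rw [hcard]
  exact dvd_pow_self 2 (PNat.ne_zero n)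

omit [NumberField K] in
/-- Every prime above `2` contains a root `b` of `X³ + pX² + qX + r` with `p, q, r` even (`b³ ∈ 2𝓞`). [folklore] -/
theorem mem_asIdeal_of_two_mem_of_even (v : HeightOneSpectrum (𝓞 K)) (h2 : ((2 : ℕ) : 𝓞 K) ∈ v.asIdeal) (b : 𝓞 K)
    {p q r : ℤ} (hp : Even p) (hq : Even q) (hr : Even r) (hb : b ^ 3 + p * b ^ 2 + q * b + r = 0) :
    b ∈ v.asIdeal := by
  obtain ⟨p', rfl⟩ := hp
  obtain ⟨q', rfl⟩ := hq
  obtain ⟨r', rfl⟩ := hr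
  apply v.isPrime.mem_of_pow_mem 3
  have h3 : b ^ 3 = ((2 : ℕ) : 𝓞 K) * (-(p' * b ^ 2 + q' * b + r')) := by
    push_cast at hb ⊢; linear_combination hb
  rw [h3]
  exact v.asIdeal.mul_mem_right _ h2

/-- **THE EISENSTEIN CRITERION (kernel).** A CUBIC number field `K` whose ring of integers contains a root `b` of
`X³ + pX² + qX + r` with `p, q, r` EVEN and `4 ∤ r` has EXACTLY ONE prime above `2`: two distinct primes `v ≠ w` above `2` both
contain `b` and are comaximal, so `N(v)·N(w) ∣ N((b)) = |r|` with `N(v), N(w)` even — contradicting `4 ∤ r`. (In fact `2` is totally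
ramified.) [folklore] -/
theorem existsUnique_two_mem_of_eisenstein_root (h3 : Module.finrank ℚ K = 3)
    (b : 𝓞 K) {p q r : ℤ} (hp : Even p) (hq : Even q) (hr : Even r) (hr4 : ¬ (4 : ℤ) ∣ r)
    (hb : b ^ 3 + p * b ^ 2 + q * b + r = 0) :
    ∃! v : HeightOneSpectrum (𝓞 K), ((2 : ℕ) : 𝓞 K) ∈ v.asIdeal := by
  obtain ⟨v, hv⟩ := exists_heightOneSpectrum_two_mem K
  refine ⟨v, hv, fun w hw ↦ ?_⟩
  by_contra hne
  have hbv := mem_asIdeal_of_two_mem_of_even K v hv b hp hq hr hb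
  have hbw := mem_asIdeal_of_two_mem_of_even K w hw b hp hq hr hb
  have hcop : w.asIdeal ⊔ v.asIdeal = ⊤ :=
    w.isMaximal.coprime_of_ne v.isMaximal (fun h ↦ hne (HeightOneSpectrum.ext h))
  have hle : Ideal.span {b} ≤ w.asIdeal * v.asIdeal := by
    rw [Ideal.mul_eq_inf_of_coprime hcop, Ideal.span_singleton_le_iff_mem]
    exact ⟨hbw, hbv⟩
  have hdvd := Ideal.absNorm_dvd_absNorm_of_le hle
  rw [map_mul, Ideal.absNorm_span_singleton,
    norm_eq_neg_of_cubic_root K h3 b (irreducible_cubic_of_eisenstein hp hq hr hr4) hb] at hdvd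
  have h4 : 2 * 2 ∣ (-r).natAbs :=
    (mul_dvd_mul (two_dvd_absNorm_of_two_mem K w hw) (two_dvd_absNorm_of_two_mem K v hv)).trans hdvd
  rw [Int.natAbs_neg] at h4
  have h4' : ((2 * 2 : ℕ) : ℤ) ∣ r := Int.ofNat_dvd_left.mpr h4
  exact hr4 (by norm_num at h4'; exact h4')

end EisensteinCriterion

/-! ## §3 The cubic currency `ℚ(β)` -/

section CubicCurrency

variable {p q r : ℤ}

/-- `[ℚ(β) : ℚ] = 3` for a root `β` of an Eisenstein-at-`2` cubic. [folklore] -/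
theorem finrank_adjoin_eq_three_of_eisenstein (hp : Even p) (hq : Even q) (hr : Even r) (hr4 : ¬ (4 : ℤ) ∣ r)
    {β : AlgebraicClosure ℚ} (hβ : aeval β (Cubic.toPoly ⟨1, (p : ℚ), q, r⟩) = 0) :
    Module.finrank ℚ (IntermediateField.adjoin ℚ {β}) = 3 := by
  have hfm : (Cubic.toPoly ⟨1, (p : ℚ), q, r⟩).Monic := Cubic.monic_of_a_eq_one'
  have hβint : IsIntegral ℚ β := ⟨_, hfm, by rwa [← aeval_def]⟩
  rw [IntermediateField.adjoin.finrank hβint,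
    ← minpoly.eq_of_irreducible_of_monic (irreducible_cubic_of_eisenstein hp hq hr hr4) hβ hfm]
  exact Cubic.natDegree_of_a_ne_zero' one_ne_zero

/-- **`p, q, r` even and `4 ∤ r` ⟹ EXACTLY ONE prime of `ℚ(β)` above `2`** (`β ∈ ℚ̄` any root of `X³ + pX² + qX + r`) — the
«splitting of `2`» datum of the unique-prime door decided from `(p, q, r) mod 4`. KERNEL. [folklore] -/
theorem existsUnique_two_mem_adjoin_of_eisenstein (hp : Even p) (hq : Even q) (hr : Even r) (hr4 : ¬ (4 : ℤ) ∣ r)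
    {β : AlgebraicClosure ℚ} (hβ : aeval β (Cubic.toPoly ⟨1, (p : ℚ), q, r⟩) = 0) :
    ∃! v : HeightOneSpectrum (𝓞 (IntermediateField.adjoin ℚ {β})),
      ((2 : ℕ) : 𝓞 (IntermediateField.adjoin ℚ {β})) ∈ v.asIdeal := by
  have hfm : (Cubic.toPoly ⟨1, (p : ℚ), q, r⟩).Monic := Cubic.monic_of_a_eq_one'
  have hβint : IsIntegral ℚ β := ⟨_, hfm, by rwa [← aeval_def]⟩
  haveI : FiniteDimensional ℚ (IntermediateField.adjoin ℚ {β}) := IntermediateField.adjoin.finiteDimensional hβint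
  haveI : NumberField (IntermediateField.adjoin ℚ {β}) := NumberField.mk
  obtain ⟨b, -, hb⟩ := exists_ringOfIntegers_cubic_root (p := p) (q := q) (r := r) hβ
  exact existsUnique_two_mem_of_eisenstein_root _ (finrank_adjoin_eq_three_of_eisenstein hp hq hr hr4 hβ)
    b hp hq hr hr4 hb

/-- **`μ₂ = 0` FOR `ℚ(β)` ON THE EISENSTEIN BLOCK, modulo ONE parity bit — UNCONDITIONAL otherwise.** For `p q r : ℤ` even with
`4 ∤ r`, every root `β ∈ ℚ̄` of `X³ + pX² + qX + r`, and `2 ∤ #Cl(𝓞 ℚ(β))`: Iwasawa's classical `μ₂` vanishes (growth form) along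
EVERY `ℤ₂`-extension of `ℚ(β)` (Iwasawa 1956 through the Eisenstein criterion, both kernel).
[cite: Greenberg2001IwasawaPastPresent, Prop. 2.1 p. 339] [cite: Washington1997, Prop. 13.22] -/
theorem classicalMuVanishes_two_adjoin_of_eisenstein (hp : Even p) (hq : Even q) (hr : Even r) (hr4 : ¬ (4 : ℤ) ∣ r)
    {β : AlgebraicClosure ℚ} (hβ : aeval β (Cubic.toPoly ⟨1, (p : ℚ), q, r⟩) = 0)
    (hh : ¬ 2 ∣ Nat.card (ClassGroup (𝓞 (IntermediateField.adjoin ℚ {β}))))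
    (κ : ZpExtension (IntermediateField.adjoin ℚ {β}) 2) : ClassicalMuVanishes κ :=
  classicalMuVanishes_two_adjoin_of_unique_prime β hh (existsUnique_two_mem_adjoin_of_eisenstein hp hq hr hr4 hβ) κ

/-- The strong form: `e_n = 0` for every layer of every `ℤ₂`-extension of `ℚ(β)` on the Eisenstein block (`2 ∤ #Cl(𝓞 ℚ(β))`).
[cite: Greenberg2001IwasawaPastPresent, Prop. 2.1 p. 339] -/
theorem classNumberPExp_eq_zero_adjoin_of_eisenstein (hp : Even p) (hq : Even q) (hr : Even r) (hr4 : ¬ (4 : ℤ) ∣ r)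
    {β : AlgebraicClosure ℚ} (hβ : aeval β (Cubic.toPoly ⟨1, (p : ℚ), q, r⟩) = 0)
    (hh : ¬ 2 ∣ Nat.card (ClassGroup (𝓞 (IntermediateField.adjoin ℚ {β}))))
    (κ : ZpExtension (IntermediateField.adjoin ℚ {β}) 2) (n : ℕ) : classNumberPExp κ n = 0 := by
  have hfm : (Cubic.toPoly ⟨1, (p : ℚ), q, r⟩).Monic := Cubic.monic_of_a_eq_one'
  have hβint : IsIntegral ℚ β := ⟨_, hfm, by rwa [← aeval_def]⟩
  haveI : FiniteDimensional ℚ (IntermediateField.adjoin ℚ {β}) := IntermediateField.adjoin.finiteDimensional hβint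
  haveI : NumberField (IntermediateField.adjoin ℚ {β}) := NumberField.mk
  exact classNumberPExp_eq_zero_of_odd_classNumber_of_unique_prime _ hh
    (existsUnique_two_mem_adjoin_of_eisenstein hp hq hr hr4 hβ) κ n

end CubicCurrency

/-! ## §4 Per curve (mod `hLim2`): the Eisenstein block of the unique-prime door -/

section PerCurve

variable {p q r : ℤ}

/-- **(A)₂ from ONE parity bit, per curve, Eisenstein block.** Granted Lim 2017 Thm. 3.5 at `2` BY NAME (`hLim2`): for any
elliptic `W/ℚ` and any non-zero `P ∈ W[2]` whose point field `ℚ(P)` is `ℚ(β)` for a root `β` of `X³ + pX² + qX + r` (`p q r` even,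
`4 ∤ r`), `2 ∤ #Cl(𝓞 ℚ(β))` ⟹ statement (A)₂(W) (`∃ γ D` currency of C1″). CONDITIONAL on `hLim2` and the displayed bit.
[cite: Lim2017FineSelmer, §3 Thm. 3.5 and Lemma 3.2] [cite: Greenberg2001IwasawaPastPresent, Prop. 2.1 p. 339] [cite: CoatesSujatha2005, §3 statement (A)] -/
theorem fineSelmerDual_moduleFinite_two_of_eisenstein_pointField
    (hLim2 : Lim2017.thm35_at_two_fineSelmerDual_moduleFinite_of_classicalMuVanishes_of_le_divisionField_four)
    (W : WeierstrassCurve ℚ) [W.IsElliptic] {P : geomTorsion W 2} (hP : P ≠ 0)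
    (hp : Even p) (hq : Even q) (hr : Even r) (hr4 : ¬ (4 : ℤ) ∣ r)
    {β : AlgebraicClosure ℚ} (hβ : aeval β (Cubic.toPoly ⟨1, (p : ℚ), q, r⟩) = 0)
    (hF : IntermediateField.fixedField (MulAction.stabilizer (absoluteGaloisGroup ℚ) P) = IntermediateField.adjoin ℚ {β})
    (hh : ¬ 2 ∣ Nat.card (ClassGroup (𝓞 (IntermediateField.adjoin ℚ {β}))))
    (κ : ZpExtension ℚ 2) (hκ : κ.IsCyclotomic) :
    ∃ (γ : absoluteGaloisGroup ℚ) (D : W.FineSelmerDualData κ γ),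
      Module.Finite ℤ_[2] (RestrictScalars ℤ_[2] (IwasawaAlgebra 2) D.X) := by
  have hμP : ∀ κL : ZpExtension (IntermediateField.fixedField (MulAction.stabilizer (absoluteGaloisGroup ℚ) P)) 2,
      κL.IsCyclotomic → ClassicalMuVanishes κL := by
    rw [hF]; exact fun κL _ ↦ classicalMuVanishes_two_adjoin_of_eisenstein hp hq hr hr4 hβ hh κL
  exact fineSelmerDual_moduleFinite_two_of_classicalMu_pointField hLim2 W hP hμP κ hκ

/-- **The cubic model itself**, Eisenstein block: for `W : y² = x³ + px² + qx + r` over `ℚ` (`p q r` even, `4 ∤ r`) and a root `β`,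
the `2`-torsion point `(β, 0)` has point field `ℚ(β)`, so `2 ∤ #Cl(𝓞 ℚ(β))` ⟹ (A)₂(W), granted `hLim2`.
[cite: Lim2017FineSelmer, §3 Thm. 3.5 and Lemma 3.2] [cite: Greenberg2001IwasawaPastPresent, Prop. 2.1 p. 339] -/
theorem fineSelmerDual_moduleFinite_two_cubicModel_of_eisenstein
    (hLim2 : Lim2017.thm35_at_two_fineSelmerDual_moduleFinite_of_classicalMuVanishes_of_le_divisionField_four)
    (hp : Even p) (hq : Even q) (hr : Even r) (hr4 : ¬ (4 : ℤ) ∣ r) [(⟨0, (p : ℚ), 0, q, r⟩ : WeierstrassCurve ℚ).IsElliptic]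
    {β : AlgebraicClosure ℚ} (hβ : aeval β (Cubic.toPoly ⟨1, (p : ℚ), q, r⟩) = 0)
    (hh : ¬ 2 ∣ Nat.card (ClassGroup (𝓞 (IntermediateField.adjoin ℚ {β}))))
    (κ : ZpExtension ℚ 2) (hκ : κ.IsCyclotomic) :
    ∃ (γ : absoluteGaloisGroup ℚ) (D : (⟨0, (p : ℚ), 0, q, r⟩ : WeierstrassCurve ℚ).FineSelmerDualData κ γ),
      Module.Finite ℤ_[2] (RestrictScalars ℤ_[2] (IwasawaAlgebra 2) D.X) := by
  obtain ⟨P₀, hP₀, hP₀eq⟩ := exists_geomTorsion_two_eq_some_root (p : ℚ) q r hβ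
  exact fineSelmerDual_moduleFinite_two_of_eisenstein_pointField hLim2 _ hP₀ hp hq hr hr4 hβ
    (fixedField_stabilizer_eq_adjoin_root (p : ℚ) q r hβ hP₀eq) hh κ hκ

end PerCurve

/-! ## §5 Example: the pure cubic field `ℚ(∛2)` -/

section Example

/-- **`μ₂ = 0` for `ℚ(∛2)` modulo ONE bit.** For every root `θ ∈ ℚ̄` of `X³ − 2` (Eisenstein at `2`: `2 = 𝔭³` in `ℚ(θ)`, kernel)
and granted only `2 ∤ #Cl(𝓞 ℚ(θ))` (in print `h = 1`; not kernel), Iwasawa's `μ₂` vanishes (growth form) along EVERY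
`ℤ₂`-extension of `ℚ(θ)`. [cite: Greenberg2001IwasawaPastPresent, Prop. 2.1 p. 339] [cite: Cohen1993, App. B (tables of cubic fields)] -/
theorem classicalMuVanishes_pureCubicField_two {θ : AlgebraicClosure ℚ}
    (hθ : aeval θ (Cubic.toPoly ⟨1, ((0 : ℤ) : ℚ), ((0 : ℤ) : ℚ), ((-2 : ℤ) : ℚ)⟩) = 0)
    (hh : ¬ 2 ∣ Nat.card (ClassGroup (𝓞 (IntermediateField.adjoin ℚ {θ}))))
    (κ : ZpExtension (IntermediateField.adjoin ℚ {θ}) 2) : ClassicalMuVanishes κ :=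
  classicalMuVanishes_two_adjoin_of_eisenstein (p := 0) (q := 0) (r := -2) (by decide) (by decide) (by decide) (by decide)
    hθ hh κ

end Example

end Summit.BirchSwinnertonDyer.BirchSwinnertonDyer.Theorems.AddKatoTwo

end
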